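import Summits.BirchSwinnertonDyer.BirchSwinnertonDyer.Theorems.EdixhovenFibreFiveSevenStarredOptimalManinUnitFiveSevenReceptacleNoTorsion
import Summits.BirchSwinnertonDyer.BirchSwinnertonDyer.Theorems.EdixhovenFibreFiveSevenStarredOptimalManinUnitFiveSevenReceptacleLogLattice
import Summits.BirchSwinnertonDyer.BirchSwinnertonDyer.Theorems.EdixhovenFibreFiveSevenStarredOptimalManinUnitFiveSevenTraceDual
import HarnessLib

/-!
# F″ programme, pieces P2 ⊕ P3 COMPOSED: the RECEPTACLE EXIT `exp*_ω(H¹(K, T_pE)) ⊆ 𝒪_K` over an unramified `K`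
# — every `a` in the (S5b)-range has `‖a‖ ≤ 1` (`--supports stmt-BirchSwinnertonDyer-22226`, helper; route EdixhovenFibreFiveSeven)

HONEST FRAMING. Route `EdixhovenFibreFiveSeven`, crux K★ `StarredOptimalManinUnitFiveSeven`
(stmt-BirchSwinnertonDyer-22226), line `kato-lever` (K★ ⟸ F″, p581141). The F″ programme map
(`Cruxes/StarredOptimalManinUnitFiveSeven/Lines/kato-lever-F2-programme.md` §4) reads Kato's classes through the
receptacle `exp*_ω(H¹(K_v, T_pE)) ⊆ 𝒪_{K_v}` at the tame cyclotomic completions `K_v`, UNRAMIFIED over `ℚ_p`. The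
Tate-duality fact (S5b) `PAdicHodge.exists_smul_range_expStarCoord_iff_trace_log` says the range of `exp*_{e•ω}` is
`{a : ∀ P ∈ E(K), Tr_{K/ℚ_p}(a·log_ω P) ∈ ℤ_p}`; piece **P2** (seat edix-p1 g5, p596837/p597608:
`…Receptacle{LogLattice,NoTorsion}`) shows this trace condition forces `Tr_{K/ℚ_p}(a·𝒪_K) ⊆ ℤ_p` (`log_ω(E₀(K)) = 𝒪_K`
off the Kosters–Pannekoek exception, resp. with no hypothesis on K★'s starred locus `p ∈ {5,7}`, `4 ≤ v_pΔ_min`); piece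
**P3** (this seat, p596840 `…TraceDual`) shows `Tr_{K/ℚ_p}(a·𝒪_K) ⊆ ℤ_p ⇒ ‖a‖ ≤ 1` for UNRAMIFIED `K` (different `(1)`).
THIS FILE composes them into the one-line EXIT the semi-local assembly (P4) consumes: **every `a` in the (S5b)-range
has `‖a‖ ≤ 1`**, stated (i) for the trace condition itself, (ii) for any map `Φ` whose range is characterised by it
(the literal shape of (S5b)'s conclusion `∃ e ≠ 0, ∀ a, (∃ η, exp*_{e•ω} η = a) ↔ ∀ P, ‖Tr(a·log_ω P)‖ ≤ 1`), in both the
general form (cuspidal `M/ℤ_p`, `p` odd, `E₀(K)[p] = 0`) and the hypothesis-free K★ form. TOOL theorems only (no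
definition, no named fact, no `sorry`); closes nothing by itself; (S5b) itself is NOT instantiated here (that is the
`K_v = ℚ(ζ_m)_v` junction of P4); BSD is not proved by any of this.

## Contents (`K ⊇ ℚ_p` complete, finite-dimensional, unramified `hK`; `log_ω = FormalGroupChart.padicLogPointFiniteExt ‖·‖ E p`)

* `norm_le_one_of_forall_point` — general: `M/ℤ_p` cuspidal (`‖Δ‖, ‖c₄‖ < 1`), `p` odd, `E₀(K)[p] = 0`:
  `(∀ P ∈ E(K), ‖Tr(a·log_ω P)‖ ≤ 1) ⇒ ‖a‖ ≤ 1`; `forall_norm_le_one_of_range_iff_forall_point` — the (S5b)-socket form.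
* ★ `norm_le_one_of_forall_point_of_addv_of_four_le` — K★ form: `W/ℚ` globally minimal, `p ∈ {5,7}` additive,
  `4 ≤ v_pΔ_min`, minimal model `W_ℤ ⊗ K`: `(∀ P, ‖Tr(a·log_ω P)‖ ≤ 1) ⇒ ‖a‖ ≤ 1`;
  ★ `forall_norm_le_one_of_range_iff_forall_point_of_addv_of_four_le` — its (S5b)-socket form: for any `Φ : X → K`
  with `(∃ x, Φ x = a) ↔ ∀ P, ‖Tr(a·log_ω P)‖ ≤ 1`, every value of `Φ` lies in `𝒪_K`.

References: C.-H. Kim, K. Nakamura, J. Number Theory 210 (2020), Cor. 2.4 [KimNakamura2020]; J.-P. Serre, *Local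
Fields* (1979), III §3 Prop. 7, §6 Prop. 13 [SerreLocalFields1979]; S. Bloch, K. Kato (1990), Prop. 3.8 [BlochKato1990];
programme map `…/kato-lever-F2-programme.md` §4 (P2, P3, P4).
-/

set_option autoImplicit false
-- the Theorems namespace of a single-conjunct summit repeats the summit name by design (D-0017)
set_option linter.dupNamespace false

noncomputable section

open scoped Classical NNReal
open WeierstrassCurve Literature.NumberTheory.EllipticCurves Literature.NumberTheory.EllipticCurves.FormalGroupChart
open Summit.BirchSwinnertonDyer.Rank1Residual.Additive
open Summit.BirchSwinnertonDyer.Rank1Residual.Additive.BallEval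
open Summit.BirchSwinnertonDyer.BirchSwinnertonDyer.Theorems.KPort
open Summit.BirchSwinnertonDyer.BirchSwinnertonDyer.Theorems.StarredOptimalManinUnitFiveSevenTraceDual
open Literature.NumberTheory.GaloisRepresentations.LubinTate (unitBall mem_unitBall_iff)

namespace Summit.BirchSwinnertonDyer.BirchSwinnertonDyer.Theorems.StarredOptimalManinUnitFiveSevenReceptacle

variable {p : ℕ} [hp : Fact p.Prime] {K : Type*} [NontriviallyNormedField K] [NormedAlgebra ℚ_[p] K]
  [IsUltrametricDist K] [CompleteSpace K] [FiniteDimensional ℚ_[p] K]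

/-! ## §1 General cuspidal model, `p` odd, off the Kosters–Pannekoek exception -/

section General

variable {M : WeierstrassCurve ℤ_[p]} [hE : (M.map PadicInt.Coe.ringHom).IsElliptic]
  [hint : (curveK p K M).IsIntegral (NormedField.valuation (K := K)).integer]

/-- **Receptacle exit, general form.** `M/ℤ_p` with cuspidal reduction (`‖Δ‖, ‖c₄‖ < 1`), `p` odd, `K ⊇ ℚ_p` complete,
finite-dimensional and UNRAMIFIED, `E₀(K)[p] = 0`: if `‖Tr_{K/ℚ_p}(a · log_ω P)‖ ≤ 1` for every `P ∈ E(K)` then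
`‖a‖ ≤ 1` (P2: the condition gives `Tr(a·𝒪_K) ⊆ ℤ_p`; P3: the trace dual of `𝒪_K` is `𝒪_K`).
[cite: KimNakamura2020, Cor. 2.4] [cite: SerreLocalFields1979, Ch. III §6 Prop. 13] -/
theorem norm_le_one_of_forall_point (hp2 : p ≠ 2) (hK : ∀ z : K, ‖z‖ < 1 → ‖z‖ ≤ ‖(p : K)‖)
    (hΔ : ‖M.Δ‖ < 1) (hc₄ : ‖M.c₄‖ < 1)
    (hE0 : ∀ P ∈ (M.map (coeffHom p K)).nonsingularReductionSubgroup
      (Valuation.integer.integers (NormedField.valuation (K := K))), p • P = 0 → P = 0)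
    {a : K}
    (ha : ∀ P : (curveK p K M).toAffine.Point,
      ‖Algebra.trace ℚ_[p] K (a * padicLogPointFiniteExt (NormedField.valuation (K := K)) (curveK p K M) p P)‖ ≤ 1) :
    ‖a‖ ≤ 1 :=
  norm_le_one_of_forall_norm_trace_mul_le_one_of_unramified p K hK
    fun _ hy => norm_trace_mul_le_one_of_forall_point hp2 hK hΔ hc₄ hE0 ha hy

/-- **Receptacle exit, (S5b)-socket form.** Same hypotheses; if a map `Φ : X → K` (e.g. `exp*_{e•ω}` on
`H¹(K, T_pE)`) has its range characterised by the trace condition — `(∃ x, Φ x = a) ↔ ∀ P, ‖Tr(a · log_ω P)‖ ≤ 1`, the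
literal shape of the conclusion of `PAdicHodge.exists_smul_range_expStarCoord_iff_trace_log` — then every value of `Φ`
lies in `𝒪_K`. [cite: KimNakamura2020, Cor. 2.4] [cite: BlochKato1990, Prop. 3.8 (p. 354)] -/
theorem forall_norm_le_one_of_range_iff_forall_point (hp2 : p ≠ 2) (hK : ∀ z : K, ‖z‖ < 1 → ‖z‖ ≤ ‖(p : K)‖)
    (hΔ : ‖M.Δ‖ < 1) (hc₄ : ‖M.c₄‖ < 1)
    (hE0 : ∀ P ∈ (M.map (coeffHom p K)).nonsingularReductionSubgroup
      (Valuation.integer.integers (NormedField.valuation (K := K))), p • P = 0 → P = 0)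
    {X : Type*} (Φ : X → K)
    (hΦ : ∀ a : K, (∃ x, Φ x = a) ↔ ∀ P : (curveK p K M).toAffine.Point,
      ‖Algebra.trace ℚ_[p] K (a * padicLogPointFiniteExt (NormedField.valuation (K := K)) (curveK p K M) p P)‖ ≤ 1)
    (x : X) : ‖Φ x‖ ≤ 1 :=
  norm_le_one_of_forall_point hp2 hK hΔ hc₄ hE0 ((hΦ (Φ x)).mp ⟨x, rfl⟩)

end General

/-! ## §2 K★'s locus: `W/ℚ` globally minimal, `p ∈ {5,7}` additive, `4 ≤ v_pΔ_min` — no torsion hypothesis -/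

section KStar

variable (W : WeierstrassCurve ℚ) [W.IsElliptic] [W.IsGloballyMinimal]
  [(curveK p K ((integralModelInt W).map (Int.castRingHom ℤ_[p]))).IsIntegral
    (NormedField.valuation (K := K)).integer]

/-- ★ **Receptacle exit on K★'s locus.** `W/ℚ` globally minimal, `p ∈ {5,7}` additive with `4 ≤ v_pΔ_min` (Kodaira
IV, I₀*, IV*, III*, II* ⊇ the starred locus), `K ⊇ ℚ_p` complete, finite-dimensional and UNRAMIFIED, minimal model
`W_ℤ ⊗ K`: if `‖Tr_{K/ℚ_p}(a · log_ω P)‖ ≤ 1` for every `P ∈ E(K)`, then `‖a‖ ≤ 1` — i.e. `exp*_ω(H¹(K, T_pE)) ⊆ 𝒪_K`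
once (S5b) identifies the range. [cite: KimNakamura2020, Thm. 2.1 and Cor. 2.4] [cite: SerreLocalFields1979, Ch. III §6 Prop. 13] -/
theorem norm_le_one_of_forall_point_of_addv_of_four_le (hp57 : p = 5 ∨ p = 7) (hadd : Rank1Residual.Addv W p)
    (hv : 4 ≤ padicValInt p W.minimalDiscriminantInt) (hK : ∀ z : K, ‖z‖ < 1 → ‖z‖ ≤ ‖(p : K)‖) {a : K}
    (ha : ∀ P : (curveK p K ((integralModelInt W).map (Int.castRingHom ℤ_[p]))).toAffine.Point,
      ‖Algebra.trace ℚ_[p] K (a * padicLogPointFiniteExt (NormedField.valuation (K := K))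
        (curveK p K ((integralModelInt W).map (Int.castRingHom ℤ_[p]))) p P)‖ ≤ 1) :
    ‖a‖ ≤ 1 :=
  norm_le_one_of_forall_norm_trace_mul_le_one_of_unramified p K hK
    fun _ hy => norm_trace_mul_le_one_of_forall_point_of_addv_of_four_le W hp57 hadd hv hK ha hy

/-- ★ **Receptacle exit on K★'s locus, (S5b)-socket form**: for any `Φ : X → K` whose range is characterised by the
trace condition against `log_ω` of the minimal model (the conclusion shape of
`PAdicHodge.exists_smul_range_expStarCoord_iff_trace_log`), every value of `Φ` lies in `𝒪_K`.
[cite: KimNakamura2020, Cor. 2.4] [cite: BlochKato1990, Prop. 3.8 (p. 354)] -/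
theorem forall_norm_le_one_of_range_iff_forall_point_of_addv_of_four_le (hp57 : p = 5 ∨ p = 7)
    (hadd : Rank1Residual.Addv W p) (hv : 4 ≤ padicValInt p W.minimalDiscriminantInt)
    (hK : ∀ z : K, ‖z‖ < 1 → ‖z‖ ≤ ‖(p : K)‖) {X : Type*} (Φ : X → K)
    (hΦ : ∀ a : K, (∃ x, Φ x = a) ↔
      ∀ P : (curveK p K ((integralModelInt W).map (Int.castRingHom ℤ_[p]))).toAffine.Point,
        ‖Algebra.trace ℚ_[p] K (a * padicLogPointFiniteExt (NormedField.valuation (K := K))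
          (curveK p K ((integralModelInt W).map (Int.castRingHom ℤ_[p]))) p P)‖ ≤ 1)
    (x : X) : ‖Φ x‖ ≤ 1 :=
  norm_le_one_of_forall_point_of_addv_of_four_le W hp57 hadd hv hK ((hΦ (Φ x)).mp ⟨x, rfl⟩)

end KStar

end Summit.BirchSwinnertonDyer.BirchSwinnertonDyer.Theorems.StarredOptimalManinUnitFiveSevenReceptacle

end
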